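import Literature.NumberTheory.GaloisRepresentations.IdeleClassBarModAlphaOneInjective
import HarnessLib

/-!
# The transport `U_L = Gal(F̄/L) ≃* Γ_L = Gal(L̄/L)` and its compatibility with restriction to the finite ABELIAN
# layers `K ⊆ L̄` embedded in the layers `M ⊇ L` of `F̄`; `ℤ/m`-characters of `Gal(E/L)` factor through abelian layers
# (Galois theory bookkeeping for Milne ADT I Thm. 1.8 (b), idèle class formation at an open subgroup)

Topic `NumberTheory/GaloisRepresentations`; namespace `Literature.NumberTheory.GaloisRepresentations.IdeleClassBar`.
Sequel to door-c4 g16's `IdeleClassBarModPairingArtin.lean` (`galTraceQuotEquiv h : Gal(E/L) ≃* U_L ⧸ (U_E ∩ U_L)`)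
and `IdeleClassBarModAlphaOneInjective.lean` (`GalLayer.exists_ge_nonempty_algHom`: every finite `K/L` embeds over `L`
into a layer `M ⊇ L` of `F̄`).  Definitions with bodies (`GalLayer.absGalEquiv`) and theorems; NO named fact, no
instance, no notation, no `sorry`.

THE POINT.  door-c6 g14's surjectivity theorem for Milne's `α¹(Γ_L, ℤ/m)` (`IdeleClassAlphaOneLayers`,
`exists_idele_forall_layer_pairing_eq (F := L)`) is phrased with the finite abelian `K ⊆ L̄ = AlgebraicClosure L` and
THE restriction `absRestrictNormalHom K : Γ_L → Gal(K/L)`, whereas door-c4's classes of `Ext¹_{C_{U_L}}(ℤ, ℤ/m)` live on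
the open subgroup `U_L = Gal(F̄/L) ≤ Γ_F` and are read on the trace layers `U_L ⧸ (U_M ∩ U_L) ≅ Gal(M/L)` of the layers
`M ⊇ L` of `F̄` (door-c4 g16 B1–B3).  The bridge:

* **`GalLayer.absGalEquiv L : U_L ≃* Γ_L`** — `u ↦ θ ∘ u ∘ θ⁻¹` for THE (random, fixed) `L`-isomorphism
  `θ : F̄ ≃ₐ[L] L̄` (`IsAlgClosure.equiv`; Mathlib `IntermediateField.fixingSubgroupEquiv`, `AlgEquiv.autCongr`);
* **`restrictNormal_autCongr_eq_of_isMulCommutative`** (pure Galois theory) — for `K/L` normal with COMMUTATIVE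
  `Gal(K/L)`, `K ⊆ Ω'`, `K → M ⊆ Ω` and `σ ∈ Gal(M/L)` the restriction of `u ∈ Aut_L(Ω)`:
  `(θ ∘ u ∘ θ⁻¹)|_K = σ|_K` for ANY `θ : Ω ≃ₐ[L] Ω'` (the two `L`-embeddings of `K` into `Ω'` differ by an element of
  `Gal(K/L)`, which conjugates trivially);
* **`absRestrictNormalHom_absGalEquiv`** — hence `absRestrictNormalHom K (absGalEquiv L u) = (u|_M)|_K` for every
  finite ABELIAN `K ⊆ L̄`, every layer `M ⊇ L` and every `L`-embedding `K → M` (`u|_M = (galTraceQuotEquiv h)⁻¹ [u]`);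
* **`exists_isAbelianGalois_character_factor`** — every additive character `χ : Gal(E/L) → A` (`E ⊇ L` a layer, `A`
  commutative) factors as `χ_K ∘ res` through a finite ABELIAN `K ⊆ L̄` embedded in `E` over `L` (`K ≅ E^{ker χ}`,
  realized in `L̄` by `IntermediateField.equivMap`).

HONEST FRAMING: Galois theory bookkeeping; no arithmetic, no case of BSD or of Poitou–Tate.  Route A (A5)-ARITH of crux
`AnticycControlAdditiveK` (item 19295, cell bsd-schneider), seat door-c4 gen 17 (surjectivity half of the field
`adjointBijective_one_zmod` of door-c4 g15's `TateDualityHypotheses (classBarD F) (classBarInvD F)`).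

## References
* J. W. S. Cassels, A. Fröhlich (eds.), *Algebraic Number Theory* (1967), Ch. VII (J. Tate) §11.1. [CasselsFrohlichANT1967]
* J.-P. Serre, *Local Fields* (1979), XI §1. [Serre1979]
* J. S. Milne, *Arithmetic Duality Theorems* (2nd ed. 2006), I §1 Theorem 1.8 (b). [MilneADT2006]
-/

noncomputable section

open NumberField CategoryTheory groupCohomology
open Field (absoluteGaloisGroup)
open Literature.NumberTheory.Automorphic Literature.NumberTheory.Automorphic.IdeleClassGroup
open Literature.NumberTheory.NumberFields
open Literature.Algebra.Homology Literature.Algebra.Homology.DiscreteRep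
open scoped Classical

namespace Literature.NumberTheory.GaloisRepresentations

namespace IdeleClassBar

/-! ## §35. Pure Galois theory: conjugation transport and restriction to an abelian layer -/

section Galois

variable {L Ω Ω' M K : Type} [Field L] [Field Ω] [Field Ω'] [Field M] [Field K]
  [Algebra L Ω] [Algebra L Ω'] [Algebra L M] [Algebra L K]
  [Algebra M Ω] [IsScalarTower L M Ω] [Algebra K M] [IsScalarTower L K M]
  [Algebra K Ω'] [IsScalarTower L K Ω'] [Normal L K]

/-- **`(θ ∘ u ∘ θ⁻¹)|_K = σ|_K` for `K/L` normal with commutative Galois group.**  Here `u ∈ Aut_L(Ω)`, `θ : Ω ≃ₐ[L] Ω'`,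
`K ⊆ Ω'`, `K → M ⊆ Ω` over `L`, and `σ ∈ Aut_L(M)` is the restriction of `u` to `M`; the two `L`-embeddings
`K ⊆ Ω'` and `θ ∘ (K → M ⊆ Ω)` differ by an element `τ ∈ Gal(K/L)` (`AlgHom.restrictNormal'`), so that
`(θ u θ⁻¹)|_K = τ σ|_K τ⁻¹ = σ|_K`. [cite: Serre1979, XI §1][cite: CasselsFrohlichANT1967, Ch. VII §11.1] -/
theorem restrictNormal_autCongr_eq_of_isMulCommutative [IsMulCommutative (K ≃ₐ[L] K)]
    (θ : Ω ≃ₐ[L] Ω') (u : Ω ≃ₐ[L] Ω) (σ : M ≃ₐ[L] M)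
    (hσ : ∀ x : M, algebraMap M Ω (σ x) = u (algebraMap M Ω x)) :
    (θ.autCongr u).restrictNormal K = σ.restrictNormal K := by
  -- the `L`-embedding `K → M ⊆ Ω ≃ Ω'` and the element `τ ∈ Gal(K/L)` comparing it with `K ⊆ Ω'`
  let ϕ : K →ₐ[L] Ω' :=
    θ.toAlgHom.comp ((IsScalarTower.toAlgHom L M Ω).comp (IsScalarTower.toAlgHom L K M))
  have hϕ : ∀ k : K, ϕ k = θ (algebraMap M Ω (algebraMap K M k)) := fun k => rfl
  let τ : K ≃ₐ[L] K := ϕ.restrictNormal' K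
  have hτ : ∀ k : K, algebraMap K Ω' (τ k) = ϕ k := fun k => by
    have h := AlgHom.restrictNormal_commutes ϕ K k
    rw [Algebra.algebraMap_self, RingHom.id_apply] at h
    exact h
  have hc : τ * σ.restrictNormal K = σ.restrictNormal K * τ :=
    IsMulCommutative.is_comm.comm τ (σ.restrictNormal K)
  refine AlgEquiv.ext fun k => (algebraMap K Ω').injective ?_
  rw [AlgEquiv.restrictNormal_commutes (θ.autCongr u) K k, AlgEquiv.autCongr_apply, AlgEquiv.trans_apply,
    AlgEquiv.trans_apply]
  -- `θ⁻¹ k = (K → M ⊆ Ω) (τ⁻¹ k)`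
  have h1 : θ.symm (algebraMap K Ω' k) = algebraMap M Ω (algebraMap K M (τ.symm k)) := by
    rw [AlgEquiv.symm_apply_eq, ← hϕ, ← hτ, AlgEquiv.apply_symm_apply]
  -- `u` acts on `M` as `σ`, `σ` on `K` as `σ|_K`
  have h2 : u (algebraMap M Ω (algebraMap K M (τ.symm k))) =
      algebraMap M Ω (algebraMap K M (σ.restrictNormal K (τ.symm k))) := by
    rw [← hσ, AlgEquiv.restrictNormal_commutes σ K (τ.symm k)]
  -- `τ σ|_K τ⁻¹ = σ|_K`
  have h3 : τ (σ.restrictNormal K (τ.symm k)) = σ.restrictNormal K k := by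
    change (τ * σ.restrictNormal K) (τ.symm k) = σ.restrictNormal K k
    rw [hc]
    change σ.restrictNormal K (τ (τ.symm k)) = σ.restrictNormal K k
    rw [AlgEquiv.apply_symm_apply]
  rw [h1, h2, ← hϕ, ← hτ, h3]

/-- The same for Mathlib's `restrictNormalHom`. [cite: Serre1979, XI §1] -/
theorem restrictNormalHom_autCongr_eq_of_isMulCommutative [IsMulCommutative (K ≃ₐ[L] K)]
    (θ : Ω ≃ₐ[L] Ω') (u : Ω ≃ₐ[L] Ω) (σ : M ≃ₐ[L] M)
    (hσ : ∀ x : M, algebraMap M Ω (σ x) = u (algebraMap M Ω x)) :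
    AlgEquiv.restrictNormalHom K (θ.autCongr u) = AlgEquiv.restrictNormalHom K σ :=
  restrictNormal_autCongr_eq_of_isMulCommutative θ u σ hσ

end Galois

/-! ## §36. `U_L ≃* Γ_L` -/

variable {F : Type} [Field F]

namespace GalLayer

/-- `F̄` is an algebraic closure of every layer `L` (algebraically closed, algebraic over `F ⊆ L`).
[cite: CasselsFrohlichANT1967, Ch. VII §11.1] -/
theorem isAlgClosure (L : GalLayer F) : IsAlgClosure L.1 (AlgebraicClosure F) :=
  ⟨inferInstance, Algebra.IsAlgebraic.tower_top (K := F) L.1⟩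

/-- **THE `L`-isomorphism `θ_L : F̄ ≃ₐ[L] L̄`** (`L̄ = AlgebraicClosure L`; a fixed random choice, Mathlib
`IsAlgClosure.equiv`). [cite: CasselsFrohlichANT1967, Ch. VII §11.1] -/
def closureEquiv (L : GalLayer F) : AlgebraicClosure F ≃ₐ[L.1] AlgebraicClosure L.1 :=
  haveI := L.isAlgClosure
  IsAlgClosure.equiv L.1 (AlgebraicClosure F) (AlgebraicClosure L.1)

/-- **`U_L = Gal(F̄/L) ≃* Γ_L = Gal(L̄/L)`**, `u ↦ θ_L ∘ u ∘ θ_L⁻¹` (Mathlib `IntermediateField.fixingSubgroupEquiv`: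
`U_L ≃* Aut_L(F̄)`, then conjugation `AlgEquiv.autCongr θ_L`, then the tree's identity `absoluteGaloisGroup.toAlgEquiv`).
[cite: CasselsFrohlichANT1967, Ch. VII §11.1][cite: Serre1979, XI §1] -/
def absGalEquiv (L : GalLayer F) :
    (L.openNormalSubgroup : Subgroup (absoluteGaloisGroup F)) ≃* absoluteGaloisGroup L.1 :=
  ((IntermediateField.fixingSubgroupEquiv L.1).trans L.closureEquiv.autCongr).trans
    (absoluteGaloisGroup.toAlgEquiv L.1).symm

/-- Formula: `toAlgEquiv (absGalEquiv L u) = θ_L.autCongr û` with `û = u` as an `L`-automorphism of `F̄`.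
[cite: CasselsFrohlichANT1967, Ch. VII §11.1] -/
theorem toAlgEquiv_absGalEquiv (L : GalLayer F) (u : (L.openNormalSubgroup : Subgroup (absoluteGaloisGroup F))) :
    absoluteGaloisGroup.toAlgEquiv L.1 (L.absGalEquiv u) =
      L.closureEquiv.autCongr (IntermediateField.fixingSubgroupEquiv L.1 u) := rfl

/-- `û x = u x`: the `L`-automorphism `fixingSubgroupEquiv L u` of `F̄` is `u` on elements.
[cite: CasselsFrohlichANT1967, Ch. VII §11.1] -/
theorem fixingSubgroupEquiv_apply (L : GalLayer F) (u : (L.openNormalSubgroup : Subgroup (absoluteGaloisGroup F)))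
    (x : AlgebraicClosure F) :
    IntermediateField.fixingSubgroupEquiv L.1 u x = (u : absoluteGaloisGroup F) • x := rfl

end GalLayer

/-! ## §37. `u|_M` as an `L`-automorphism of a layer `M ⊇ L`, and `absRestrictNormalHom K (absGalEquiv L u) = (u|_M)|_K` -/

variable {L M : GalLayer F}

/-- **`(galTraceQuotEquiv h)⁻¹ [u]` is `u|_M`**: for `u ∈ U_L` and a layer `M ⊇ L`, the `L`-automorphism of `M`
corresponding to `[u] ∈ U_L ⧸ (U_M ∩ U_L)` under door-c4 g16's `g : Gal(M/L) ≃* U_L ⧸ (U_M ∩ U_L)` acts on `M ⊆ F̄` as `u`.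
[cite: Serre1979, XI §1 (iv)] -/
theorem coe_galTraceQuotEquiv_symm_mk_apply (h : L ≤ M)
    (u : (L.openNormalSubgroup : Subgroup (absoluteGaloisGroup F))) (x : M.1) :
    (((galTraceQuotEquiv h).symm (QuotientGroup.mk u) : letI := GalLayer.algebraOfLE h; (M.1 ≃ₐ[L.1] M.1)) x :
        AlgebraicClosure F) =
      (u : absoluteGaloisGroup F) • (x : AlgebraicClosure F) := by
  letI := GalLayer.algebraOfLE h
  have h1 : galResHom h ((galTraceQuotEquiv h).symm (QuotientGroup.mk u)) =
      M.restrictHom (u : absoluteGaloisGroup F) := by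
    change galResHom h ((galEquivSubgroupImage h).symm
      (GalLayer.subgroupImageEquiv (L.openNormalSubgroup : Subgroup (absoluteGaloisGroup F)) M (QuotientGroup.mk u))) = _
    rw [← coe_galEquivSubgroupImage h, MulEquiv.apply_symm_apply, GalLayer.coe_subgroupImageEquiv_mk]
  have h2 : ((galResHom h ((galTraceQuotEquiv h).symm (QuotientGroup.mk u)) x : M.1) : AlgebraicClosure F) =
      ((M.restrictHom (u : absoluteGaloisGroup F) x : M.1) : AlgebraicClosure F) := by
    rw [h1]
  rw [GalLayer.coe_restrictHom_apply] at h2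
  exact h2

/-- The same with `algebraMap M F̄` and the `L`-automorphism `û = fixingSubgroupEquiv L u` of `F̄` (the form consumed by
§35). [cite: Serre1979, XI §1 (iv)] -/
theorem algebraMap_galTraceQuotEquiv_symm_mk_apply (h : L ≤ M)
    (u : (L.openNormalSubgroup : Subgroup (absoluteGaloisGroup F))) (x : M.1) :
    algebraMap M.1 (AlgebraicClosure F)
        (((galTraceQuotEquiv h).symm (QuotientGroup.mk u) : letI := GalLayer.algebraOfLE h; (M.1 ≃ₐ[L.1] M.1)) x) =
      IntermediateField.fixingSubgroupEquiv L.1 u (algebraMap M.1 (AlgebraicClosure F) x) := by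
  rw [IntermediateField.algebraMap_apply, IntermediateField.algebraMap_apply, GalLayer.fixingSubgroupEquiv_apply]
  exact coe_galTraceQuotEquiv_symm_mk_apply h u x

set_option maxHeartbeats 800000 in
-- instance unification through `IntermediateField`s of two algebraic closures is slow
/-- **`absRestrictNormalHom K (absGalEquiv L u) = (u|_M)|_K`** for every finite ABELIAN `K ⊆ L̄`, every layer
`M ⊇ L` and every `L`-embedding `ψ : K → M` (giving the algebra structure `K → M`): THE restriction of the transported
element of `Γ_L` is the restriction of `u|_M = (galTraceQuotEquiv h)⁻¹ [u]` (§35 with `Ω = F̄`, `Ω' = L̄`, `θ = θ_L`).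
[cite: Serre1979, XI §1][cite: CasselsFrohlichANT1967, Ch. VII §11.1] -/
theorem absRestrictNormalHom_absGalEquiv (h : L ≤ M)
    (u : (L.openNormalSubgroup : Subgroup (absoluteGaloisGroup F)))
    (K : IntermediateField L.1 (AlgebraicClosure L.1)) [IsAbelianGalois L.1 K]
    (ψ : letI := GalLayer.algebraOfLE h; K →ₐ[L.1] M.1) :
    letI := GalLayer.algebraOfLE h; letI : Algebra K M.1 := ψ.toRingHom.toAlgebra;
    haveI : IsScalarTower L.1 K M.1 := IsScalarTower.of_algebraMap_eq fun r => (ψ.commutes r).symm;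
    absRestrictNormalHom K (L.absGalEquiv u) =
      AlgEquiv.restrictNormalHom K ((galTraceQuotEquiv h).symm (QuotientGroup.mk u)) := by
  letI := GalLayer.algebraOfLE h
  letI : Algebra K M.1 := ψ.toRingHom.toAlgebra
  haveI : IsScalarTower L.1 K M.1 := IsScalarTower.of_algebraMap_eq fun r => (ψ.commutes r).symm
  haveI : IsScalarTower L.1 M.1 (AlgebraicClosure F) := IsScalarTower.of_algebraMap_eq fun _ => rfl
  have hσ := algebraMap_galTraceQuotEquiv_symm_mk_apply h u
  have key := restrictNormalHom_autCongr_eq_of_isMulCommutative (K := K) (M := M.1) (Ω := AlgebraicClosure F)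
    (Ω' := AlgebraicClosure L.1) L.closureEquiv (IntermediateField.fixingSubgroupEquiv L.1 u)
    ((galTraceQuotEquiv h).symm (QuotientGroup.mk u)) hσ
  calc absRestrictNormalHom K (L.absGalEquiv u)
      = AlgEquiv.restrictNormalHom K (absoluteGaloisGroup.toAlgEquiv L.1 (L.absGalEquiv u)) := rfl
    _ = AlgEquiv.restrictNormalHom K (L.closureEquiv.autCongr (IntermediateField.fixingSubgroupEquiv L.1 u)) := by
          rw [GalLayer.toAlgEquiv_absGalEquiv]
    _ = _ := key

/-! ## §38. An additive character of `Gal(E/L)` factors through a finite ABELIAN layer `K ⊆ Ω` embedded in `E` -/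

section Factor

variable {L E Ω : Type} [Field L] [Field E] [Field Ω] [Algebra L E] [Algebra L Ω]
  [FiniteDimensional L E] [IsGalois L E] [IsAlgClosed Ω] {A : Type} [AddCommGroup A]

/-- **Every additive character `χ : Gal(E/L) → A` (`E/L` finite Galois, `A` commutative) factors through a finite
ABELIAN extension `K ⊆ Ω` of `L` embedded in `E`**: `χ = χ_K ∘ res_K` for `K ≅ E^{ker χ}` (Galois with group
`Gal(E/L)/ker χ ↪ A`, hence abelian), realized inside the algebraically closed `Ω` by an `L`-embedding `E → Ω`
(`IntermediateField.equivMap`), with the `L`-embedding `ψ : K → E` defining the restriction `res_K`.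
[cite: CasselsFrohlichANT1967, Ch. VII §11.1][cite: Serre1979, XI §1] -/
theorem exists_isAbelianGalois_character_factor (χ : Additive (E ≃ₐ[L] E) →+ A) :
    ∃ (K : IntermediateField L Ω) (_ : FiniteDimensional L K) (_ : IsAbelianGalois L K) (ψ : K →ₐ[L] E)
      (χK : Additive (K ≃ₐ[L] K) →+ A),
      letI : Algebra K E := ψ.toRingHom.toAlgebra
      haveI : IsScalarTower L K E := IsScalarTower.of_algebraMap_eq fun r => (ψ.commutes r).symm
      χ = χK.comp (MonoidHom.toAdditive (AlgEquiv.restrictNormalHom K)) := by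
  -- the kernel of `χ` and its fixed field `K₀ ⊆ E`
  let χ' : (E ≃ₐ[L] E) →* Multiplicative A := AddMonoidHom.toMultiplicativeRight χ
  have hχ' : ∀ σ, χ' σ = Multiplicative.ofAdd (χ (Additive.ofMul σ)) := fun σ => rfl
  let H : Subgroup (E ≃ₐ[L] E) := χ'.ker
  let K₀ : IntermediateField L E := IntermediateField.fixedField H
  have hker : (AlgEquiv.restrictNormalHom K₀ : (E ≃ₐ[L] E) →* (K₀ ≃ₐ[L] K₀)).ker = H := by
    rw [IntermediateField.restrictNormalHom_ker K₀]
    exact IntermediateField.fixingSubgroup_fixedField H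
  have hsurj : Function.Surjective (AlgEquiv.restrictNormalHom K₀ : (E ≃ₐ[L] E) → (K₀ ≃ₐ[L] K₀)) :=
    AlgEquiv.restrictNormalHom_surjective E
  -- `Gal(K₀/L) = Gal(E/L)/ker χ` is commutative
  haveI : IsMulCommutative (K₀ ≃ₐ[L] K₀) := ⟨⟨fun a b => by
    obtain ⟨σ, rfl⟩ := hsurj a
    obtain ⟨τ, rfl⟩ := hsurj b
    rw [← map_mul, ← map_mul, ← mul_inv_eq_one, ← map_inv, ← map_mul, ← MonoidHom.mem_ker, hker,
      MonoidHom.mem_ker, map_mul, map_inv, map_mul, map_mul, mul_comm (χ' τ) (χ' σ), mul_inv_cancel]⟩⟩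
  haveI : IsAbelianGalois L K₀ := IsAbelianGalois.mk
  -- the factored character on `K₀`
  let χ₀ : (K₀ ≃ₐ[L] K₀) →* Multiplicative A :=
    MonoidHom.liftOfSurjective (AlgEquiv.restrictNormalHom K₀) hsurj ⟨χ', hker.le⟩
  have hχ₀ : ∀ σ : E ≃ₐ[L] E, χ₀ (AlgEquiv.restrictNormalHom K₀ σ) = χ' σ := fun σ =>
    MonoidHom.liftOfRightInverse_comp_apply _ _ _ ⟨χ', hker.le⟩ σ
  -- realize `K₀` inside `Ω`
  haveI : Algebra.IsAlgebraic L E := Algebra.IsAlgebraic.of_finite L E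
  let f : E →ₐ[L] Ω := IsAlgClosed.lift
  let K : IntermediateField L Ω := K₀.map f
  let e : K₀ ≃ₐ[L] K := K₀.equivMap f
  haveI : FiniteDimensional L K := LinearEquiv.finiteDimensional e.toLinearEquiv
  haveI : IsAbelianGalois L K := IsAbelianGalois.of_algHom (K := L) (L := K) (M := K₀) e.symm.toAlgHom
  let ψ : K →ₐ[L] E := K₀.val.comp e.symm.toAlgHom
  have hψ : ∀ k : K, ψ k = ((e.symm k : K₀) : E) := fun k => rfl
  refine ⟨K, inferInstance, inferInstance, ψ, MonoidHom.toAdditiveLeft (χ₀.comp e.symm.autCongr.toMonoidHom), ?_⟩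
  letI : Algebra K E := ψ.toRingHom.toAlgebra
  haveI : IsScalarTower L K E := IsScalarTower.of_algebraMap_eq fun r => (ψ.commutes r).symm
  -- `e⁻¹ σ|_K e = σ|_{K₀}`
  have hres : ∀ σ : E ≃ₐ[L] E, e.symm.autCongr (AlgEquiv.restrictNormalHom K σ) = AlgEquiv.restrictNormalHom K₀ σ :=
    fun σ => AlgEquiv.ext fun k₀ => Subtype.ext (by
      change ((e.symm.autCongr (AlgEquiv.restrictNormalHom K σ) k₀ : K₀) : E) =
        algebraMap K₀ E (AlgEquiv.restrictNormalHom K₀ σ k₀)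
      rw [AlgEquiv.autCongr_apply, AlgEquiv.trans_apply, AlgEquiv.trans_apply, AlgEquiv.symm_symm, ← hψ]
      change algebraMap K E (σ.restrictNormal K (e k₀)) = algebraMap K₀ E (σ.restrictNormal K₀ k₀)
      rw [AlgEquiv.restrictNormal_commutes, AlgEquiv.restrictNormal_commutes]
      change σ (ψ (e k₀)) = σ (k₀ : E)
      rw [hψ, AlgEquiv.symm_apply_apply])
  refine AddMonoidHom.ext fun σ => ?_
  rw [AddMonoidHom.comp_apply, MonoidHom.toAdditive_apply_apply, MonoidHom.toAdditiveLeft_apply_apply,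
    MonoidHom.comp_apply, MulEquiv.coe_toMonoidHom, toMul_ofMul, hres, hχ₀, hχ', toAdd_ofAdd, ofMul_toMul]

end Factor

end IdeleClassBar

end Literature.NumberTheory.GaloisRepresentations

end
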